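/-
COR-CM (cell pub-hodgecm2) — RSCONJ («`RecordSystem.conj`», IDENT-LEMMA component (e) «SPACE by construction»), row Sc′-LIT (RSCONJ lead ruling
HOME∕INBOX l.15276): the CONJUGATE COMPLEX RECORD SYSTEM as a structure literal.  Pen prover-pub-hodgecm2-d2bridge-prove-5-g2-0.  Imports the
RSCONJ FRAME (mukey-p6), rsconj-p1's `RecordSystemConjShimuraSet` (`shimuraSetConj`), rsconj-p2's `RecordSystemConjHol` (`ComplexRecordSystem.hol_conj`)
and this seat's `RecordSystemConjPieces` (`complexPieces_conj_of_pointFormula_refl`).  KERNEL: two definitions by explicit formula (`conjPts`, the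
structure literal `conjComplexRecordSystem`) + theorems; no instance, no notation, no named fact, no `sorry`.  HC_CM is NOT proved; HELD — WORLD = C FINAL.
-/
import Summits.HodgeConjecture.CorCM.B01.Transposition.HComp.RecordSystemConjFrame
import Summits.HodgeConjecture.CorCM.B01.Transposition.HComp.RecordSystemConjShimuraSet
import Summits.HodgeConjecture.CorCM.B01.Transposition.HComp.RecordSystemConjHol
import Summits.HodgeConjecture.CorCM.B01.Transposition.HComp.RecordSystemConjPieces
import HarnessLib

/-!
# RSCONJ: the conjugate complex record system `Sc′`

For a complex record system `Sc : ComplexRecordSystem L H τ T hT K₀` of `Sh(U(H), 𝔹²)` below `K₀`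
([Deligne1979ShimuraVarieties] 2.1.2–2.1.4 over `ℂ`), the functor `conjMc Sc : K' ↦ conj(Mc_{c⁻¹K'})` (FRAME §4) carries a complex
record system for the conjugate hermitian space `(cH, τ, T̄ = conjFrame T)` below `c(K₀)`:

* `conjPts Sc K' : conj(Mc_{c⁻¹K'})(ℂ) ≃ₜ Sh_{K'}(U(cH), 𝔹²)(ℂ)` — Serre's `conj(Y)(ℂ) ≃ₜ Y(ℂ)` (`AlgPoints.conjugateHomeomorph`)⁻¹,
  then `Sc.pts (c⁻¹K')`, then `shimuraSetConj` `[x, aK] ↦ [x̄, (c⊗1)(a) K']`;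
* `conjPts_symm_mk` — the point formula **(P_ℂ)** `conjPts⁻¹ [x, aK'] = toConjugate ((Sc.pts (c⁻¹K'))⁻¹ [x̄, (c⊗1)⁻¹ a])`, by `rfl`;
* `conjPts_map_pts` (transitions), `hol_conjMc` (from `ComplexRecordSystem.hol_conj`), `pieces_conjMc`
  (from `complexPieces_conj_of_pointFormula_refl`);
* `conjComplexRecordSystem Sc : ComplexRecordSystem L (conjGram L H) τ (conjFrame T) (formCongr_conjFrame L H τ T hT) (conjLevel₀ L H K₀)`,
  with `Mc = conjMc Sc` and `pts = conjPts Sc` by `rfl`, and (P_ℂ) for `Sc := R.complexRecordSystem` in the record's own currency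
  (`conjComplexRecordSystem_pts_symm_mk_record`) — the `Sc′`∕`hP` inputs of the assembly `exists_conj_of_complexSide`.

References: [Deligne1979ShimuraVarieties] 2.1.2–2.1.4; [Milne2005ShimuraVarieties] §12, Lemma 5.13; [SerreGAGA1956] §2.
-/

set_option autoImplicit false

noncomputable section

open CategoryTheory AlgebraicGeometry NumberField IsDedekindDomain Matrix
open Literature.AlgebraicGeometry.Motives
open Literature.NumberTheory.Automorphic.Liu2021.AppendixC (C5.OpenCompactSubgroup C5.SmallLevel)

namespace Summit.HodgeConjecture.CorCM.Model.RecordSystemConj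

/-! ## Sc′-LIT: the conjugate COMPLEX record system as a structure literal (prove-5 g2; RSCONJ lead ruling HOME∕INBOX l.15276) -/

section ScLit

open Limits
open Literature.AlgebraicGeometry.ShimuraVarieties Literature.AlgebraicGeometry.ShimuraVarieties.UnitaryCanonicalModel
open Literature.AlgebraicGeometry.Motives.AlgPoints (toConjugate ofConjugate conjugateHomeomorph)
open Literature.NumberTheory.Automorphic Literature.NumberTheory.Automorphic.UnitaryGroup
open Literature.NumberTheory.Automorphic.ShimuraDissection
open Literature.Geometry.ComplexHyperbolic Literature.Geometry.ComplexHyperbolic.BallModel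
open Summit.HodgeConjecture.CorCM.D2Bridge.UnitaryGroupConj
open MulAction

variable {L : Type} [Field L] [NumberField L] [IsCMField L] {H : Matrix (Fin 3) (Fin 3) L}
  {τ : L →+* ℂ} {T : GL (Fin 3) ℂ} {hT : formCongr (starRingEnd ℂ) T (H.map τ) = BallModel.J}
  {K₀ : C5.OpenCompactSubgroup ↥(finAdelic (↥(maximalRealSubfield L)) L (IsCMField.complexConj L) 3 H)}

/-- The level hypothesis of `shimuraSetConj` at a re-indexed level: `a ∈ (c ⊗ 1)⁻¹ K' ↔ (c ⊗ 1) a ∈ K'`. [folklore] -/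
theorem mem_smallLevelConjBack_iff (K' : C5.SmallLevel (conjLevel₀ L H K₀))
    (a : finAdelic (↥(maximalRealSubfield L)) L (IsCMField.complexConj L) 3 H) :
    a ∈ (((smallLevelConjBack L H K₀).obj K').1.1 :
        Subgroup ↥(finAdelic (↥(maximalRealSubfield L)) L (IsCMField.complexConj L) 3 H)) ↔
      groupConj L H a ∈ (K'.1.1 : Subgroup ↥(finAdelic (↥(maximalRealSubfield L)) L (IsCMField.complexConj L) 3 (conjGram L H))) :=
  mem_transport_symm_iff_groupConj_mem L H K'.1 a

/-- **`conjPts`, the complex points of the conjugate complex model**: for a complex record system `Sc` of `Sh(U(H), 𝔹²)` below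
`K₀` and a small level `K' ≤ c(K₀)` of `U(cH)(𝔸_{L⁺,f})`, the identification
`conj(Mc_{c⁻¹K'})(ℂ) ≃ₜ Sh_{K'}(U(cH), 𝔹²)(ℂ)` = (Serre's anti-holomorphic identification `conj(Y)(ℂ) ≃ₜ Y(ℂ)`,
`AlgPoints.conjugateHomeomorph`)⁻¹, then `Sc.pts (c⁻¹K')`, then rsconj-p1's `shimuraSetConj` `[x, aK] ↦ [x̄, (c⊗1)(a) K']`.
[cite: SerreGAGA1956, §2] [cite: Milne2005ShimuraVarieties, Lemma 5.13 p. 57 and §12] -/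
def conjPts (Sc : ComplexRecordSystem L H τ T hT K₀) (K' : C5.SmallLevel (conjLevel₀ L H K₀)) :
    ComplexPoints ((baseChangeHom (starRingAut : ℂ ≃+* ℂ).toRingHom).obj
        (Sc.Mc.obj ((smallLevelConjBack L H K₀).obj K'))) ≃ₜ
      ShimuraSet L (conjGram L H) τ (conjFrame T) (formCongr_conjFrame L H τ T hT) K'.1.1 :=
  ((conjugateHomeomorph conjAut (Sc.Mc.obj ((smallLevelConjBack L H K₀).obj K')) Complex.continuous_conj).symm.trans
      (Sc.pts ((smallLevelConjBack L H K₀).obj K'))).trans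
    (shimuraSetConj L H τ T hT
      (((smallLevelConjBack L H K₀).obj K').1.1 :
        Subgroup ↥(finAdelic (↥(maximalRealSubfield L)) L (IsCMField.complexConj L) 3 H))
      K'.1.1 (mem_smallLevelConjBack_iff K'))

/-- **(P_ℂ) — the RSCONJ point formula, by `rfl`**: `conjPts⁻¹ [x, aK'] = toConjugate ((Sc.pts (c⁻¹K'))⁻¹ [x̄, (c⊗1)⁻¹(a) · c⁻¹K'])`.
[cite: Milne2005ShimuraVarieties, Lemma 5.13 p. 57 and §12] -/
theorem conjPts_symm_mk (Sc : ComplexRecordSystem L H τ T hT K₀) (K' : C5.SmallLevel (conjLevel₀ L H K₀))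
    (x : Ball) (a : finAdelic (↥(maximalRealSubfield L)) L (IsCMField.complexConj L) 3 (conjGram L H)) :
    (conjPts Sc K').symm (ShimuraSet.mk L (conjGram L H) τ (conjFrame T) (formCongr_conjFrame L H τ T hT) K'.1.1 x a) =
      toConjugate conjAut (Sc.Mc.obj ((smallLevelConjBack L H K₀).obj K'))
        ((Sc.pts ((smallLevelConjBack L H K₀).obj K')).symm
          (ShimuraSet.mk L H τ T hT ((smallLevelConjBack L H K₀).obj K').1.1 (conjBall x) ((groupConj L H).symm a))) :=
  rfl

/-- `conjPts` of a conjugated point is the `shimuraSetConj`-image of `Sc.pts` of the point. [cite: SerreGAGA1956, §2] -/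
theorem conjPts_toConjugate (Sc : ComplexRecordSystem L H τ T hT K₀)
    (K' : C5.SmallLevel (conjLevel₀ L H K₀)) (Q : ComplexPoints (Sc.Mc.obj ((smallLevelConjBack L H K₀).obj K'))) :
    conjPts Sc K' (toConjugate conjAut (Sc.Mc.obj ((smallLevelConjBack L H K₀).obj K')) Q) =
      shimuraSetConj L H τ T hT
        (((smallLevelConjBack L H K₀).obj K').1.1 :
          Subgroup ↥(finAdelic (↥(maximalRealSubfield L)) L (IsCMField.complexConj L) 3 H))
        K'.1.1 (mem_smallLevelConjBack_iff K') (Sc.pts ((smallLevelConjBack L H K₀).obj K') Q) := by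
  show shimuraSetConj L H τ T hT _ K'.1.1 (mem_smallLevelConjBack_iff K')
      (Sc.pts ((smallLevelConjBack L H K₀).obj K')
        (ofConjugate conjAut (Sc.Mc.obj ((smallLevelConjBack L H K₀).obj K'))
          (toConjugate conjAut (Sc.Mc.obj ((smallLevelConjBack L H K₀).obj K')) Q))) = _
  rw [AlgPoints.ofConjugate_toConjugate]

/-- (C2a) transitions for `Sc′`: `[z, aK'₁] ↦ [z, aK'₂]` on complex points (naturality of `toConjugate` + `Sc.map_pts` +
`shimuraSetConj_mk`). [cite: Deligne1979ShimuraVarieties, 2.1.4] -/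
theorem conjPts_map_pts (Sc : ComplexRecordSystem L H τ T hT K₀) (K₁ K₂ : C5.SmallLevel (conjLevel₀ L H K₀)) (f : K₁ ⟶ K₂)
    (z : Ball) (a : finAdelic (↥(maximalRealSubfield L)) L (IsCMField.complexConj L) 3 (conjGram L H)) :
    conjPts Sc K₂ (AlgPoints.map
        ((conjMc Sc).map f)
        ((conjPts Sc K₁).symm (ShimuraSet.mk L (conjGram L H) τ (conjFrame T) (formCongr_conjFrame L H τ T hT) K₁.1.1 z a))) =
      ShimuraSet.mk L (conjGram L H) τ (conjFrame T) (formCongr_conjFrame L H τ T hT) K₂.1.1 z a := by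
  show conjPts Sc K₂ (AlgPoints.map
      ((baseChangeHom (starRingAut : ℂ ≃+* ℂ).toRingHom).map (Sc.Mc.map ((smallLevelConjBack L H K₀).map f)))
      ((conjPts Sc K₁).symm
        (ShimuraSet.mk L (conjGram L H) τ (conjFrame T) (formCongr_conjFrame L H τ T hT) K₁.1.1 z a))) = _
  rw [conjPts_symm_mk, map_baseChangeHom_map_toConjugate, conjPts_toConjugate, Sc.map_pts, shimuraSetConj_mk,
    conjBall_conjBall, ContinuousMulEquiv.apply_symm_apply]

/-- (C2b) for `Sc′`: `z ↦ [z, aK']` is holomorphic on the tautological ball of `(cH)^τ` in every algebraic coordinate of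
`conj(Mc_{c⁻¹K'})` — rsconj-p2's `ComplexRecordSystem.hol_conj` read through (P_ℂ). [cite: SerreGAGA1956, §2] -/
theorem hol_conjMc (Sc : ComplexRecordSystem L H τ T hT K₀) (K' : C5.SmallLevel (conjLevel₀ L H K₀))
    (a : finAdelic (↥(maximalRealSubfield L)) L (IsCMField.complexConj L) 3 (conjGram L H)) :
    ∃ u : (Fin 3 → ℂ) → ComplexPoints
        ((conjMc Sc).obj K'),
      (∀ x : Ball, u (((conjFrame T : GL (Fin 3) ℂ) : Matrix (Fin 3) (Fin 3) ℂ) *ᵥ BallModel.lift x) =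
          (conjPts Sc K').symm (ShimuraSet.mk L (conjGram L H) τ (conjFrame T) (formCongr_conjFrame L H τ T hT) K'.1.1 x a)) ∧
      (∀ v ∈ negCone ((conjGram L H).map τ), ∀ c : ℂ, c ≠ 0 → u (c • v) = u v) ∧
      ∀ (U : ((conjMc Sc).obj K').left.affineOpens)
        (f : ((conjMc Sc).obj K').left.presheaf.obj
          (Opposite.op (↑U : ((conjMc Sc).obj K').left.Opens))),
        DifferentiableOn ℂ
          (fun v ↦ AlgPoints.evalOrZero (↑U : ((conjMc Sc).obj K').left.Opens) f (u v))
          (negCone ((conjGram L H).map τ) ∩ u ⁻¹' {P | P.pt ∈ (↑U : ((conjMc Sc).obj K').left.Opens)}) := by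
  obtain ⟨u, h1, h2, h3⟩ :=
    ComplexRecordSystem.hol_conj Sc ((smallLevelConjBack L H K₀).obj K') ((groupConj L H).symm a)
  exact ⟨u, fun x => (h1 x).trans (conjPts_symm_mk Sc K' x a).symm, h2, h3⟩

/-- (C2c) for `Sc′`: the pieces of `conj(Mc_{c⁻¹K'})` — `complexPieces_conj_of_pointFormula_refl` fed (P_ℂ).
[cite: Deligne1979ShimuraVarieties, 2.1.2] [cite: Milne2005ShimuraVarieties, Lemma 5.13 p. 57] -/
theorem pieces_conjMc (Sc : ComplexRecordSystem L H τ T hT K₀) (K' : C5.SmallLevel (conjLevel₀ L H K₀)) :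
    ∃ (g : orbitRel.Quotient (rational (↥(maximalRealSubfield L)) L (IsCMField.complexConj L) 3 (conjGram L H))
          (CosetSpace (rationalToFinAdelic (↥(maximalRealSubfield L)) L (IsCMField.complexConj L) 3 (conjGram L H)) K'.1.1) →
        finAdelic (↥(maximalRealSubfield L)) L (IsCMField.complexConj L) 3 (conjGram L H))
      (_ : ∀ q, Quotient.mk'' (CosetSpace.pt (rationalToFinAdelic _ L _ 3 (conjGram L H)) K'.1.1 (g q)) = q)
      (X : orbitRel.Quotient (rational (↥(maximalRealSubfield L)) L (IsCMField.complexConj L) 3 (conjGram L H))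
          (CosetSpace (rationalToFinAdelic (↥(maximalRealSubfield L)) L (IsCMField.complexConj L) 3 (conjGram L H)) K'.1.1) →
        SchemeOver ℂ)
      (ι : ∀ q, X q ⟶ (conjMc Sc).obj K')
      (_ : IsColimit (Cofan.mk ((conjMc Sc).obj K') ι))
      (B : ∀ q, UnitaryBallUniformisationDatum 2 (X q)),
      ∀ q, (B q).Hℂ = (conjGram L H).map τ ∧
        (B q).Γ.map (Matrix.GeneralLinearGroup.map ((B q).τ₁ : ↥(B q).E →+* ℂ)) =
          (arithmeticLevel (↥(maximalRealSubfield L)) L (IsCMField.complexConj L) 3 (conjGram L H)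
            (K'.1.1.map (MulAut.conj (g q)).toMonoidHom)).map (Matrix.GeneralLinearGroup.map τ) ∧
        ∀ x : Ball, AlgPoints.map (ι q)
            ((B q).unif (((conjFrame T : GL (Fin 3) ℂ) : Matrix (Fin 3) (Fin 3) ℂ) *ᵥ BallModel.lift x)) =
          (conjPts Sc K').symm (ShimuraSet.mk L (conjGram L H) τ (conjFrame T) (formCongr_conjFrame L H τ T hT) K'.1.1 x (g q)) :=
  complexPieces_conj_of_pointFormula_refl Sc ((smallLevelConjBack L H K₀).obj K') K'.1.1
    (map_groupConj_smallLevelConjBack L H K₀ K') (conjPts Sc K') (conjPts_symm_mk Sc K')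

/-- **Sc′ — the CONJUGATE COMPLEX RECORD SYSTEM**, as a structure literal.  For a complex record system `Sc` of
`Sh(U(H), 𝔹²)` below `K₀` ([Deligne1979ShimuraVarieties] 2.1.2–2.1.4 over `ℂ`), the system `K' ↦ conj(Mc_{c⁻¹K'})`
(`conj(·) = · ×_{ℂ, conj} ℂ`, Serre's conjugate variety; `K' ≤ c(K₀)` a small level of `U(cH)(𝔸_{L⁺,f})`, `c⁻¹K'` its
back-transport `smallLevelConjBack`) is a complex record system for the CONJUGATE hermitian space `(cH, τ, T̄ = conjFrame T)`:
(C1) smooth ∕ projective by base change; (C2a) `pts := conjPts` with the transitions `[z, aK'₁] ↦ [z, aK'₂]`; (C2b) `hol` =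
rsconj-p2's `ComplexRecordSystem.hol_conj` read through the point formula (P_ℂ); (C2c) `pieces` =
`complexPieces_conj_of_pointFormula_refl` fed (P_ℂ).  This is the `Sc′` argument of the RSCONJ assembly `exists_conj_of_complexSide`
at `Sc := R.complexRecordSystem`.
[cite: Deligne1979ShimuraVarieties, 2.1.2–2.1.4 (PDF p. 24 of Milne's translation)] [cite: Milne2005ShimuraVarieties, §12 and Lemma 5.13 p. 57] [cite: SerreGAGA1956, §2] -/
def conjComplexRecordSystem (Sc : ComplexRecordSystem L H τ T hT K₀) :
    ComplexRecordSystem L (conjGram L H) τ (conjFrame T) (formCongr_conjFrame L H τ T hT) (conjLevel₀ L H K₀) where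
  Mc := conjMc Sc
  smooth := smooth_conjMc Sc
  projective := projective_conjMc Sc
  pts := conjPts Sc
  map_pts := conjPts_map_pts Sc
  hol := hol_conjMc Sc
  pieces := pieces_conjMc Sc

/-- The models of `Sc′` are the FRAME's `conjMc Sc` = `K' ↦ conj(Mc_{c⁻¹K'})` (by `rfl`). [cite: SerreGAGA1956, §2] -/
theorem conjComplexRecordSystem_Mc (Sc : ComplexRecordSystem L H τ T hT K₀) :
    (conjComplexRecordSystem Sc).Mc = conjMc Sc :=
  rfl

/-- The model of `Sc′` at `K'` is the conjugate variety `conj(Mc_{c⁻¹K'})` (by `rfl`). [cite: SerreGAGA1956, §2] -/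
theorem conjComplexRecordSystem_Mc_obj (Sc : ComplexRecordSystem L H τ T hT K₀) (K' : C5.SmallLevel (conjLevel₀ L H K₀)) :
    (conjComplexRecordSystem Sc).Mc.obj K' = conjugateVariety conjAut (Sc.Mc.obj ((smallLevelConjBack L H K₀).obj K')) :=
  rfl

/-- The points of `Sc′` are `conjPts` (by `rfl`). [cite: Milne2005ShimuraVarieties, Lemma 5.13 p. 57] -/
theorem conjComplexRecordSystem_pts (Sc : ComplexRecordSystem L H τ T hT K₀) (K' : C5.SmallLevel (conjLevel₀ L H K₀)) :
    (conjComplexRecordSystem Sc).pts K' = conjPts Sc K' :=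
  rfl

/-- **(P_ℂ) for `Sc′`**: `(Sc′.pts K')⁻¹ [x, aK'] = toConjugate ((Sc.pts (c⁻¹K'))⁻¹ [x̄, (c⊗1)⁻¹(a) · c⁻¹K'])` (by `rfl`) — the
hypothesis `hP` of the RSCONJ assembly at `Sc′ := conjComplexRecordSystem R.complexRecordSystem`.
[cite: Milne2005ShimuraVarieties, Lemma 5.13 p. 57 and §12] -/
theorem conjComplexRecordSystem_pts_symm_mk (Sc : ComplexRecordSystem L H τ T hT K₀)
    (K' : C5.SmallLevel (conjLevel₀ L H K₀)) (x : Ball)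
    (a : finAdelic (↥(maximalRealSubfield L)) L (IsCMField.complexConj L) 3 (conjGram L H)) :
    ((conjComplexRecordSystem Sc).pts K').symm
        (ShimuraSet.mk L (conjGram L H) τ (conjFrame T) (formCongr_conjFrame L H τ T hT) K'.1.1 x a) =
      toConjugate conjAut (Sc.Mc.obj ((smallLevelConjBack L H K₀).obj K'))
        ((Sc.pts ((smallLevelConjBack L H K₀).obj K')).symm
          (ShimuraSet.mk L H τ T hT ((smallLevelConjBack L H K₀).obj K').1.1 (conjBall x) ((groupConj L H).symm a))) :=
  rfl

/-- **(P_ℂ) for the complex shadow of a record system `R`** (the literal `hP`-shape of `exists_conj_of_complexSide`, with the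
record's own `pts` and `AlgPoints.baseChangeEquiv τ`): `(Sc′.pts K')⁻¹ [x, aK'] = toConjugate (((R.pts (c⁻¹K'))⁻¹ [x̄, (c⊗1)⁻¹ a])_τ)`
for `Sc′ := conjComplexRecordSystem R.complexRecordSystem` (by `rfl`). [cite: Deligne1979ShimuraVarieties, 2.2.5] -/
theorem conjComplexRecordSystem_pts_symm_mk_record (R : RecordSystem L H τ T hT K₀)
    (K' : C5.SmallLevel (conjLevel₀ L H K₀)) (x : Ball)
    (a : finAdelic (↥(maximalRealSubfield L)) L (IsCMField.complexConj L) 3 (conjGram L H)) :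
    letI : Algebra L ℂ := τ.toAlgebra
    ((conjComplexRecordSystem R.complexRecordSystem).pts K').symm
        (ShimuraSet.mk L (conjGram L H) τ (conjFrame T) (formCongr_conjFrame L H τ T hT) K'.1.1 x a) =
      toConjugate conjAut ((baseChangeHom τ).obj (R.M.obj ((smallLevelConjBack L H K₀).obj K')))
        (AlgPoints.baseChangeEquiv τ (R.M.obj ((smallLevelConjBack L H K₀).obj K'))
          ((R.pts ((smallLevelConjBack L H K₀).obj K')).symm
            (ShimuraSet.mk L H τ T hT ((smallLevelConjBack L H K₀).obj K').1.1 (conjBall x) ((groupConj L H).symm a)))) :=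
  rfl

end ScLit

end Summit.HodgeConjecture.CorCM.Model.RecordSystemConj

end
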